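import Mathlib.MeasureTheory.Measure.Lebesgue.Basic
import Mathlib.MeasureTheory.OuterMeasure.BorelCantelli
import Summits.HubbardSuperconductivity.HubbardSuperconductivity.Theorems.JosephsonMirrorJmCuspNormalForm
import Summits.HubbardSuperconductivity.HubbardSuperconductivity.Theorems.JosephsonMirrorJmCuspCocountableSelection
import Summits.HubbardSuperconductivity.HubbardSuperconductivity.Theorems.JosephsonMirrorJmCuspPencilFiniteness
import Summits.HubbardSuperconductivity.HubbardSuperconductivity.Theorems.JosephsonMirrorJmCuspLogColdWindowOrder
import Summits.HubbardSuperconductivity.HubbardSuperconductivity.Theorems.JosephsonMirrorJmCuspConditionalAssembly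
import Summits.HubbardSuperconductivity.HubbardSuperconductivity.Theorems.JosephsonMirrorJmCuspSummableDegeneracy
import HarnessLib

/-!
# Line `cocountable-coupling-selection` — strategist skeleton for crux `JmCusp` (stmt-HubbardSuperconductivity-2228)

Crux-strategist seat `planner-cstrat-stmt-HubbardSuperconductivity-2228-s1-0` (2026-08-17), registered with `--alt`
semantics: it does NOT touch the lead's line `Sketch` (dead at `stub_core ≡ crux`, p134917) and shares no stub with it.

THE LEVER (clause (ii) side).  The crux is `∃ (U, δ): ZEPO(U,δ) ∧ EventuallySimple(U,δ)` (p134917).  Every earlier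
line tried to prove simplicity AT the witness coupling.  Here the witness coupling is CHOSEN A POSTERIORI from a
coupling WINDOW by measure: for each fixed even `L` the Hubbard torus restricted to the `(N_L, S^z = 0)` sector is
the real symmetric LINEAR PENCIL `T + U·D`, so the set `Bad_L` of couplings at which its ground floor is degenerate is a
finite union of points and intervals (semialgebraic / Rellich; `stub_pencilFiniteness`, LANDED p152004:
off a finite exceptional set the floor dimension is locally constant, so `Bad_L ∩ (a, b)` is either FINITE or of
POSITIVE Lebesgue measure — `degenerateCouplings_finite_iff_null`); a coupling that lies in only finitely many `Bad_L`
is simple for ALL large even `L` at once, and such a coupling exists in the window as soon as the `Bad_L` are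
measure-theoretically sparse: a countable union of finite sets misses a point (`stub_cocountableSelection`, LANDED
p151542), and more generally — first Borel–Cantelli lemma — `∑_L volume (Bad_L ∩ window) < ∞` already makes
Lebesgue-almost every coupling of the window eventually simple.  So clause (ii) is replaced by the strictly weaker
residue `stub_summableDegeneracy` (rev c11-3; rev c11-2 `stub_genericSimplicity` asked `Bad_L ∩ sub-window` FINITE for
all large `L`, rev 1 `stub_noPersistentFloorMultiplet` asked it on every sub-window): a window carrying zero-excess
`d`-wave pair order has a sub-window on which the coupling-measure of floor degeneracy is SUMMABLE along `L`.  It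
tolerates symmetry-forced floor multiplets (nonzero-momentum star, `E` doublet of `C₄ᵥ`) on whole coupling intervals for
infinitely many `L`, provided their lengths are summable (`O(L^(-1-η))` suffices); accidental degeneracies, `d ± id`-type
coincidences of distinct one-dimensional irreps and every "i.o. in `L` at isolated couplings" failure mode of (ii) cost
nothing (null sets).

THE (i) SIDE is the shared open core, deliberately in WINDOW form (`stub_orderedWindow`: zero-excess pair order at every
coupling of some window `(a, b) ⊂ (0, ∞)` at one doping) — the shape every engine delivers (open sets of couplings) and
exactly the shape of the sibling item stmt-8807 `LogColdTorus.LogColdDWaveOrder`; `stub_logColdGivesWindowOrder`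
(LANDED p152504: Gibbs variational principle on the sector block at `β = κ log L` + Markov on the spectral decomposition)
makes `stmt-8807 ⇒ stub_orderedWindow` a theorem (likewise stmt-2079, stmt-1634: p152676), so the honest terminal state of
this line is `blocked-on: stmt-8807` (or any other supplier of window order) ∧ one conjecture-grade residue, not `dead`.

Composition `JmCusp_of : JmCusp` (from `stub_orderedWindow`, `stub_summableDegeneracy` BY NAME, over the landed
`jmCusp_of_windowOrder_of_eventuallySimple` / `windowOrder_mono` of `Theorems/JosephsonMirrorJmCuspConditionalAssembly`,
p153748, and Mathlib's first Borel–Cantelli lemma) is kernel-checked below (no sorry outside `stub_*`), and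
`JmCusp_of_logCold` shows it with stmt-8807's statement in place of `stub_orderedWindow`.

Disproof used: none exists for this crux (no `Cruxes/JmCusp/Disproof.lean`, no `Theorems/…JmCusp…/Negative/`, checked
`ledger crux ls` 2026-08-17T10:31Z); honoured in advance: `jmCusp_clauseII_fails_at_zero_coupling` (p142929) — the window
is bounded away from `U = 0` (`0 < a`), and `jmCusp_clauseI_false_of_const_gt` (p144720) — no constant is prescribed.

All stub statements are DEF-FREE (fully qualified), so that `--supports stmt-HubbardSuperconductivity-2228` files can
prove them by name + verbatim signature.

LEAD STATUS (prover-line-stmt-HubbardSuperconductivity-2228-c11-0, 2026-08-17).  Cycle 1: the three provable stubs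
LANDED and are folded back below by their tree theorems — `stub_pencilFiniteness` (p152004,
`Theorems/JosephsonMirrorJmCuspPencilFiniteness`), `stub_cocountableSelection` (p151542,
`Theorems/JosephsonMirrorJmCuspCocountableSelection`), `stub_logColdGivesWindowOrder` (p152504,
`Theorems/JosephsonMirrorJmCuspLogColdWindowOrder`, over `Theorems/JosephsonMirrorGibbsMarkovSelection` p152090); supplier
glue stmt-2079 / stmt-1634 ⇒ `stub_orderedWindow` (p152676, `Theorems/JosephsonMirrorJmCuspOrderedWindowSuppliers`).
Cycle 2 (rev c11-2): residue reshaped to the sub-window generic form `stub_genericSimplicity`; the sorry-free conditional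
assembly LANDED (`Theorems/JosephsonMirrorJmCuspConditionalAssembly.lean`, p153748: `jmCusp_of_orderedWindow_of_genericSimplicity`,
`jmCusp_of_{logColdDWaveOrder,bir2079,thesis1634}_of_genericSimplicity`, and the fixed-window forms
`jmCusp_of_windowOrder_of_denseSimple` ⇐ `_of_finiteDegenerate` ⇐ `_of_countable_recurrent` ⇐ `_of_eventuallySimple`).
Cycle 3 (rev c11-3, THIS FILE): residue reshaped once more, to its Borel–Cantelli form `stub_summableDegeneracy`
(implied by rev c11-2's, `summableDegeneracy_of_genericSimplicity'` below, sorry-free); the glue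
`Theorems/JosephsonMirrorJmCuspSummableDegeneracy.lean` (`jmCusp_of_orderedWindow_of_summableDegeneracy`,
`jmCusp_of_{logColdDWaveOrder,bir2079,thesis1634}_of_summableDegeneracy`, `degenerateCouplings_finite_iff_null`,
`summableDegeneracy_of_{finiteDegenerate,denseSimple,genericSimplicity}`) is proposed `--supports` stmt-2228.
Open (2 sorries, both crux-sized, none delegable): `stub_orderedWindow` — the summit's open core in window form, supplied
by ANY of the existing open items stmt-8807 (`JmCusp_of_logCold` below), stmt-2079, stmt-1634 — and
`stub_summableDegeneracy` — the conjecture-grade (ii)-residue (no theorem in print decides ground-state simplicity of the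
doped repulsive Hubbard torus at any `U > 0`; calibrations landed: (ii) false at `U = 0` p142929, true for `U < 0` p142929
and at `δ = 0` p143372), recommended for PROMOTION to an item.
-/

noncomputable section

set_option linter.dupNamespace false

namespace Summit.HubbardSuperconductivity.HubbardSuperconductivity.Cruxes.JmCusp.Lines.CocountableCouplingSelection

open scoped Classical
open Matrix Literature.MathematicalPhysics.QuantumLattice
open Summit.HubbardSuperconductivity.HubbardSuperconductivity.Theses.JosephsonMirror (JmCusp)
open Summit.HubbardSuperconductivity.HubbardSuperconductivity.Theorems.JosephsonMirror

/-! ### The registered stubs -/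

/-- `stub_orderedWindow` — THE (i)-SIDE INPUT (the shared open core, window form; crux-sized; intended supplier:
stmt-8807 `LogColdDWaveOrder` via `stub_logColdGivesWindowOrder`, or stmt-2010 via the density-matching glue of card
`sourced-envelope-zero-excess-bridge`): at some doping `δ ∈ (0, 1/2)` there is a coupling window `(a, b)`, `0 < a < b`,
at EVERY point of which zero-excess `d`-wave pair order holds (the right-hand side of
`josephsonGain_iff_zeroExcessPairOrder`, verbatim). [folklore] -/
theorem stub_orderedWindow :
    ∃ δ ∈ Set.Ioo (0:ℝ) (1 / 2), ∃ a b : ℝ, 0 < a ∧ a < b ∧ ∀ U ∈ Set.Ioo a b,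
      ∃ c : ℝ, 0 < c ∧ ∀ ε : ℝ, 0 < ε → ∃ L₀ : ℕ, ∀ (L : ℕ) [NeZero L], Even L → L₀ ≤ L → ∃ n : ℕ, (n = 2 * ⌊(1 - δ) * (L : ℝ) ^ 2 / 2⌋₊ ∨ n = 2 * ⌊(1 - δ) * (L : ℝ) ^ 2 / 2⌋₊ - 2) ∧ ∃ v : Literature.MathematicalPhysics.QuantumLattice.Fock (Literature.MathematicalPhysics.QuantumLattice.Orb (Literature.MathematicalPhysics.QuantumLattice.FermionTorus 2 L)), v ∈ Literature.MathematicalPhysics.QuantumLattice.szSector n 0 ∧ star v ⬝ᵥ v = 1 ∧ (star v ⬝ᵥ (Literature.MathematicalPhysics.QuantumLattice.hubbardTorus 2 L 1 U *ᵥ v)).re ≤ (Literature.MathematicalPhysics.QuantumLattice.hubbardTorus 2 L 1 U).minEnergyOn (Literature.MathematicalPhysics.QuantumLattice.szSector n 0) + ε * (L : ℝ) ^ 2 ∧ c * (L : ℝ) ^ 4 ≤ (star (Literature.MathematicalPhysics.QuantumLattice.pairField Literature.MathematicalPhysics.QuantumLattice.dWaveFormFactor L *ᵥ v) ⬝ᵥ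 (Literature.MathematicalPhysics.QuantumLattice.pairField Literature.MathematicalPhysics.QuantumLattice.dWaveFormFactor L *ᵥ v)).re := by
  sorry

/-- `stub_summableDegeneracy` — THE (ii)-SIDE RESIDUE, rev c11-3, Borel–Cantelli form (conjecture-grade; strictly
weaker than clause (ii) on the window, than the rev-1 residue `stub_noPersistentFloorMultiplet` and than the rev-2
residue `stub_genericSimplicity`, see `summableDegeneracy_of_genericSimplicity'`): every coupling window `(a, b)`,
`0 < a < b`, carrying zero-excess `d`-wave pair order at doping `δ` contains a SUB-window `(a', b')` on which the
Lebesgue measures of the degenerate-floor coupling sets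
`Bad_L = {U ∈ (a', b') | L ≠ 0, L even, the (N_L, S^z = 0) ground floor of hubbardTorus 2 L 1 U is not simple}`
are SUMMABLE along `L` (`∑' L, volume Bad_L ≠ ⊤`; odd `L` and `L = 0` contribute empty sets).  At fixed `L`, `Bad_L` is
finite or of positive measure (pencil structure, `degenerateCouplings_finite_iff_null`), so the residue says: the total
LENGTH of the coupling intervals on which a floor multiplet (nonzero-momentum star, `E` doublet of `C₄ᵥ`, hidden permanent
degeneracy) is the ground floor is summable in `L` — lengths `O(L^(-1-η))` are allowed for every `L`, where rev c11-2
allowed none beyond `L₁`.  Physics: a `k = 0` `d_(x²−y²)` condensate of `N_L/2` pairs has a `k = 0`,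
one-dimensional-irrep (`A₁` or `B₁`) floor with an `O(1/L)` gap inside the sector once `L ≫ ξ`, so floor-irrep flips are
confined to couplings within `O(gap) = O(1/L)`… of level crossings whose number per unit coupling does not grow; the
Anderson tower lives in OTHER charge sectors (barrier `LROForcesLowLyingStates`, respected).  Why it might fail:
finite-momentum / stripe-cat floors on coupling intervals of non-summable total length inside every ordered sub-window
(PDW, period-8 stripes near `δ = 1/8`).  No theorem in print decides simplicity of the doped repulsive floor at any
`U > 0` (known: `U < 0` and `δ = 0`, Lieb 1989; `U = 0` fails, p142929). [folklore] -/
theorem stub_summableDegeneracy :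
    ∀ δ ∈ Set.Ioo (0:ℝ) (1 / 2), ∀ a b : ℝ, 0 < a → a < b → (∀ U ∈ Set.Ioo a b, ∃ c : ℝ, 0 < c ∧ ∀ ε : ℝ, 0 < ε → ∃ L₀ : ℕ, ∀ (L : ℕ) [NeZero L], Even L → L₀ ≤ L → ∃ n : ℕ, (n = 2 * ⌊(1 - δ) * (L : ℝ) ^ 2 / 2⌋₊ ∨ n = 2 * ⌊(1 - δ) * (L : ℝ) ^ 2 / 2⌋₊ - 2) ∧ ∃ v : Literature.MathematicalPhysics.QuantumLattice.Fock (Literature.MathematicalPhysics.QuantumLattice.Orb (Literature.MathematicalPhysics.QuantumLattice.FermionTorus 2 L)), v ∈ Literature.MathematicalPhysics.QuantumLattice.szSector n 0 ∧ star v ⬝ᵥ v = 1 ∧ (star v ⬝ᵥ (Literature.MathematicalPhysics.QuantumLattice.hubbardTorus 2 L 1 U *ᵥ v)).re ≤ (Literature.MathematicalPhysics.QuantumLattice.hubbardTorus 2 L 1 U).minEnergyOn (Literature.MathematicalPhysics.QuantumLattice.szSector n 0) + ε * (L : ℝ) ^ 2 ∧ c * (L : ℝ) ^ 4 ≤ (star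 (Literature.MathematicalPhysics.QuantumLattice.pairField Literature.MathematicalPhysics.QuantumLattice.dWaveFormFactor L *ᵥ v) ⬝ᵥ (Literature.MathematicalPhysics.QuantumLattice.pairField Literature.MathematicalPhysics.QuantumLattice.dWaveFormFactor L *ᵥ v)).re) → ∃ a' b' : ℝ, a ≤ a' ∧ a' < b' ∧ b' ≤ b ∧ ∑' L : ℕ, MeasureTheory.volume {U : ℝ | U ∈ Set.Ioo a' b' ∧ L ≠ 0 ∧ Even L ∧ ¬ ∀ φ φ' : Literature.MathematicalPhysics.QuantumLattice.Fock (Literature.MathematicalPhysics.QuantumLattice.Orb (Literature.MathematicalPhysics.QuantumLattice.FermionTorus 2 L)), Literature.MathematicalPhysics.QuantumLattice.IsGroundStateInSector (Literature.MathematicalPhysics.QuantumLattice.hubbardTorus 2 L 1 U) (2 * ⌊(1 - δ) * (L : ℝ) ^ 2 / 2⌋₊) 0 φ → Literature.MathematicalPhysics.QuantumLattice.IsGroundStateInSector (Literature.MathematicalPhysics.QuantumLattice.hubbardTorus 2 L 1 U) (2 * ⌊(1 - δ) * (L : ℝ) ^ 2 / 2⌋₊) 0 φ' → ∃ c : ℂ,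 φ' = c • φ} ≠ ⊤ := by
  sorry

/-- `stub_pencilFiniteness` — REAL-ALGEBRAIC STRUCTURE OF THE BOTTOM EIGENVALUE (provable, M/L; pure finite-dimensional
mathematics, no physics, every `L`, every `δ`): `hubbardTorus 2 L 1 U = T + U·D` is a real symmetric pencil LINEAR in
`U`, and so is its compression to the `H`-invariant sector `szSector N 0`; hence the set of `U` at which the sector
ground floor is degenerate is a finite union of points and intervals (zero set in `U` of subresultants of the
characteristic polynomial `det(x − T − U D) ∈ ℝ[U][x]`, or Rellich's analytic branches: Kato 1966 Ch. II §6), and if the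
simple-floor couplings are dense in `(a, b)` no interval survives: the degenerate-floor couplings in `(a, b)` are FINITELY
MANY.  (This is the `dim = 1` form of lemma G2 of summit card `generic-u-schur-every-gs`.) [folklore] -/
theorem stub_pencilFiniteness :
    ∀ (L : ℕ) [NeZero L] (δ a b : ℝ), a < b →
      (∀ a' b' : ℝ, a ≤ a' → a' < b' → b' ≤ b → ∃ U ∈ Set.Ioo a' b', ∀ φ φ' : Literature.MathematicalPhysics.QuantumLattice.Fock (Literature.MathematicalPhysics.QuantumLattice.Orb (Literature.MathematicalPhysics.QuantumLattice.FermionTorus 2 L)), Literature.MathematicalPhysics.QuantumLattice.IsGroundStateInSector (Literature.MathematicalPhysics.QuantumLattice.hubbardTorus 2 L 1 U) (2 * ⌊(1 - δ) * (L : ℝ) ^ 2 / 2⌋₊) 0 φ → Literature.MathematicalPhysics.QuantumLattice.IsGroundStateInSector (Literature.MathematicalPhysics.QuantumLattice.hubbardTorus 2 L 1 U) (2 * ⌊(1 - δ) * (L : ℝ) ^ 2 / 2⌋₊) 0 φ' → ∃ c : ℂ, φ' = c • φ) →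
      Set.Finite {U : ℝ | U ∈ Set.Ioo a b ∧ ¬ ∀ φ φ' : Literature.MathematicalPhysics.QuantumLattice.Fock (Literature.MathematicalPhysics.QuantumLattice.Orb (Literature.MathematicalPhysics.QuantumLattice.FermionTorus 2 L)), Literature.MathematicalPhysics.QuantumLattice.IsGroundStateInSector (Literature.MathematicalPhysics.QuantumLattice.hubbardTorus 2 L 1 U) (2 * ⌊(1 - δ) * (L : ℝ) ^ 2 / 2⌋₊) 0 φ → Literature.MathematicalPhysics.QuantumLattice.IsGroundStateInSector (Literature.MathematicalPhysics.QuantumLattice.hubbardTorus 2 L 1 U) (2 * ⌊(1 - δ) * (L : ℝ) ^ 2 / 2⌋₊) 0 φ' → ∃ c : ℂ, φ' = c • φ} :=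
  Summit.HubbardSuperconductivity.HubbardSuperconductivity.Theorems.JosephsonMirror.stub_pencilFiniteness

/-- `stub_cocountableSelection` — CO-COUNTABLE SELECTION OF THE COUPLING (provable now, S/M; `Set.Finite.countable`,
`Set.countable_iUnion`, uncountability of `Set.Ioo a b` in `ℝ`, e.g. `Cardinal.mk_Ioo_real` or
`Real.volume_Ioo` + `Set.Countable.measure_zero`): if for every large even `L` only finitely many couplings of the window
have a degenerate floor, some coupling of the window has a simple floor at EVERY large even `L`. [folklore] -/
theorem stub_cocountableSelection :
    ∀ (δ a b : ℝ) (L₁ : ℕ), a < b →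
      (∀ (L : ℕ) [NeZero L], Even L → L₁ ≤ L → Set.Finite {U : ℝ | U ∈ Set.Ioo a b ∧ ¬ ∀ φ φ' : Literature.MathematicalPhysics.QuantumLattice.Fock (Literature.MathematicalPhysics.QuantumLattice.Orb (Literature.MathematicalPhysics.QuantumLattice.FermionTorus 2 L)), Literature.MathematicalPhysics.QuantumLattice.IsGroundStateInSector (Literature.MathematicalPhysics.QuantumLattice.hubbardTorus 2 L 1 U) (2 * ⌊(1 - δ) * (L : ℝ) ^ 2 / 2⌋₊) 0 φ → Literature.MathematicalPhysics.QuantumLattice.IsGroundStateInSector (Literature.MathematicalPhysics.QuantumLattice.hubbardTorus 2 L 1 U) (2 * ⌊(1 - δ) * (L : ℝ) ^ 2 / 2⌋₊) 0 φ' → ∃ c : ℂ, φ' = c • φ}) →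
      ∃ U ∈ Set.Ioo a b, ∀ (L : ℕ) [NeZero L], Even L → L₁ ≤ L → ∀ φ φ' : Literature.MathematicalPhysics.QuantumLattice.Fock (Literature.MathematicalPhysics.QuantumLattice.Orb (Literature.MathematicalPhysics.QuantumLattice.FermionTorus 2 L)), Literature.MathematicalPhysics.QuantumLattice.IsGroundStateInSector (Literature.MathematicalPhysics.QuantumLattice.hubbardTorus 2 L 1 U) (2 * ⌊(1 - δ) * (L : ℝ) ^ 2 / 2⌋₊) 0 φ → Literature.MathematicalPhysics.QuantumLattice.IsGroundStateInSector (Literature.MathematicalPhysics.QuantumLattice.hubbardTorus 2 L 1 U) (2 * ⌊(1 - δ) * (L : ℝ) ^ 2 / 2⌋₊) 0 φ' → ∃ c : ℂ, φ' = c • φ :=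
  Summit.HubbardSuperconductivity.HubbardSuperconductivity.Theorems.JosephsonMirror.stub_cocountableSelection

/-- `stub_logColdGivesWindowOrder` — WIRING THE (i)-SIDE TO THE EXISTING CORE ITEM (provable now, M): the statement of
stmt-8807 `LogColdTorus.LogColdDWaveOrder` (its `let p := …` sector predicate β/ζ-reduced in place, so that the
registered signature contains no `:=`; definitionally equal to the item's statement, see `JmCusp_of_logCold`: sector-
compressed Gibbs `d`-wave order `≥ cL⁴` at `β = κ log L`, uniformly on a coupling window, for every `κ ≥ κ₀`) implies `stub_orderedWindow` with the SAME `δ` and window.  Proof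
sketch: fix `κ = κ₀`; on the sector block `V` (dim `≤ 4^{L²}`) the Gibbs state has energy excess
`⟨H⟩_β − e ≤ log(dim V)/β ≤ L² log 4/(κ₀ log L) = o(L²)` (Gibbs variational principle); decompose it in an eigenbasis of
the block, `‖Δ_d ·‖² ≤ 32 L⁴` pointwise (`norm_pairField_dWave_sq_le`); Markov: among eigenvectors with excess
`≤ (64/c)·(mean excess)` the weighted pair amplitude is still `≥ (c/2)L⁴`, so one of them is a ZEPO witness with
`c' = c/2`, `n = N_L`. Koma–Tasaki 1994 §2; Tasaki 2020 App. A. [folklore] -/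
theorem stub_logColdGivesWindowOrder :
    (∃ δ ∈ Set.Ioo (0:ℝ) (1/2), ∃ U₁ U₂ : ℝ, 0 < U₁ ∧ U₁ < U₂ ∧ ∃ κ₀ c : ℝ, 0 < κ₀ ∧ 0 < c ∧ ∀ κ : ℝ, κ₀ ≤ κ → ∃ L₀ : ℕ, ∀ U ∈ Set.Ioo U₁ U₂, ∀ (L : ℕ) [NeZero L], L₀ ≤ L → Even L → c * (L : ℝ) ^ 4 ≤ (Matrix.gibbsState (κ * Real.log L) ((Literature.MathematicalPhysics.QuantumLattice.hubbardTorus 2 L 1 U).toBlock (fun s : Finset (Literature.MathematicalPhysics.QuantumLattice.Orb (Literature.MathematicalPhysics.QuantumLattice.FermionTorus 2 L)) => s.card = 2 * ⌊(1 - δ) * (L : ℝ) ^ 2 / 2⌋₊ ∧ 2 * (s.filter fun i => (ofLex i).2 = 0).card = 2 * ⌊(1 - δ) * (L : ℝ) ^ 2 / 2⌋₊) (fun s : Finset (Literature.MathematicalPhysics.QuantumLattice.Orb (Literature.MathematicalPhysics.QuantumLattice.FermionTorus 2 L)) => s.card = 2 * ⌊(1 - δ) * (L : ℝ) ^ 2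 / 2⌋₊ ∧ 2 * (s.filter fun i => (ofLex i).2 = 0).card = 2 * ⌊(1 - δ) * (L : ℝ) ^ 2 / 2⌋₊)) (((Literature.MathematicalPhysics.QuantumLattice.pairField Literature.MathematicalPhysics.QuantumLattice.dWaveFormFactor L)ᴴ * Literature.MathematicalPhysics.QuantumLattice.pairField Literature.MathematicalPhysics.QuantumLattice.dWaveFormFactor L).toBlock (fun s : Finset (Literature.MathematicalPhysics.QuantumLattice.Orb (Literature.MathematicalPhysics.QuantumLattice.FermionTorus 2 L)) => s.card = 2 * ⌊(1 - δ) * (L : ℝ) ^ 2 / 2⌋₊ ∧ 2 * (s.filter fun i => (ofLex i).2 = 0).card = 2 * ⌊(1 - δ) * (L : ℝ) ^ 2 / 2⌋₊) (fun s : Finset (Literature.MathematicalPhysics.QuantumLattice.Orb (Literature.MathematicalPhysics.QuantumLattice.FermionTorus 2 L)) => s.card = 2 * ⌊(1 - δ) * (L : ℝ) ^ 2 / 2⌋₊ ∧ 2 * (s.filter fun i => (ofLex i).2 = 0).card = 2 * ⌊(1 - δ) * (L : ℝ) ^ 2 / 2⌋₊))).re) →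
    ∃ δ ∈ Set.Ioo (0:ℝ) (1 / 2), ∃ a b : ℝ, 0 < a ∧ a < b ∧ ∀ U ∈ Set.Ioo a b,
      ∃ c : ℝ, 0 < c ∧ ∀ ε : ℝ, 0 < ε → ∃ L₀ : ℕ, ∀ (L : ℕ) [NeZero L], Even L → L₀ ≤ L → ∃ n : ℕ, (n = 2 * ⌊(1 - δ) * (L : ℝ) ^ 2 / 2⌋₊ ∨ n = 2 * ⌊(1 - δ) * (L : ℝ) ^ 2 / 2⌋₊ - 2) ∧ ∃ v : Literature.MathematicalPhysics.QuantumLattice.Fock (Literature.MathematicalPhysics.QuantumLattice.Orb (Literature.MathematicalPhysics.QuantumLattice.FermionTorus 2 L)), v ∈ Literature.MathematicalPhysics.QuantumLattice.szSector n 0 ∧ star v ⬝ᵥ v = 1 ∧ (star v ⬝ᵥ (Literature.MathematicalPhysics.QuantumLattice.hubbardTorus 2 L 1 U *ᵥ v)).re ≤ (Literature.MathematicalPhysics.QuantumLattice.hubbardTorus 2 L 1 U).minEnergyOn (Literature.MathematicalPhysics.QuantumLattice.szSector n 0) + ε * (L : ℝ) ^ 2 ∧ c * (L : ℝ) ^ 4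 ≤ (star (Literature.MathematicalPhysics.QuantumLattice.pairField Literature.MathematicalPhysics.QuantumLattice.dWaveFormFactor L *ᵥ v) ⬝ᵥ (Literature.MathematicalPhysics.QuantumLattice.pairField Literature.MathematicalPhysics.QuantumLattice.dWaveFormFactor L *ᵥ v)).re :=
  Summit.HubbardSuperconductivity.HubbardSuperconductivity.Theorems.JosephsonMirror.stub_logColdGivesWindowOrder

/-! ### The skeleton: FIRST theorem of crux type, concluding `JmCusp` BY NAME from the registered stubs -/

/-- `JmCusp` from the two registered stubs, by the LANDED composition `jmCusp_of_orderedWindow_of_summableDegeneracy`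
(`Theorems/JosephsonMirrorJmCuspSummableDegeneracy.lean`): the ordered window `(δ, a, b)` (`stub_orderedWindow`); a
sub-window `(a', b')` on which the coupling-measure of floor degeneracy is summable along `L` (`stub_summableDegeneracy`);
hence (first Borel–Cantelli lemma) Lebesgue-a.e. coupling of `(a', b')` has an eventually simple floor, one such `U` exists
(`volume (a', b') > 0`); at that `U` the window order gives `ZEPO(U, δ)`, and the normal form p134917
(`jmCusp_iff_zeroExcessPairOrder_and_simple`) assembles the crux.  No `sorry` outside the stubs. [folklore] -/
theorem JmCusp_of : JmCusp :=
  jmCusp_of_orderedWindow_of_summableDegeneracy stub_orderedWindow stub_summableDegeneracy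

/-! ### The (i)-side wired to stmt-8807 -/

/-- The crux from stmt-8807's statement plus the residue stub: the honest dependency of the (i)-side on the existing core item
`LogColdTorus.LogColdDWaveOrder` (stmt-8807), kernel-checked (`stub_logColdGivesWindowOrder`, p152504; tree forms
`jmCusp_of_logColdDWaveOrder_of_summableDegeneracy`, and likewise `jmCusp_of_bir2079_of_summableDegeneracy` for stmt-2079 and
`jmCusp_of_thesis1634_of_summableDegeneracy` for stmt-1634, in `Theorems/JosephsonMirrorJmCuspSummableDegeneracy.lean`). [folklore] -/
theorem JmCusp_of_logCold
    (h8807 : ∃ δ ∈ Set.Ioo (0:ℝ) (1/2), ∃ U₁ U₂ : ℝ, 0 < U₁ ∧ U₁ < U₂ ∧ ∃ κ₀ c : ℝ, 0 < κ₀ ∧ 0 < c ∧ ∀ κ : ℝ, κ₀ ≤ κ → ∃ L₀ : ℕ, ∀ U ∈ Set.Ioo U₁ U₂, ∀ (L : ℕ) [NeZero L], L₀ ≤ L → Even L → let p : Finset (Literature.MathematicalPhysics.QuantumLattice.Orb (Literature.MathematicalPhysics.QuantumLattice.FermionTorus 2 L)) → Prop := fun s => s.card = 2 * ⌊(1 -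 δ) * (L : ℝ) ^ 2 / 2⌋₊ ∧ 2 * (s.filter fun i => (ofLex i).2 = 0).card = 2 * ⌊(1 - δ) * (L : ℝ) ^ 2 / 2⌋₊; c * (L : ℝ) ^ 4 ≤ (Matrix.gibbsState (κ * Real.log L) ((Literature.MathematicalPhysics.QuantumLattice.hubbardTorus 2 L 1 U).toBlock p p) (((Literature.MathematicalPhysics.QuantumLattice.pairField Literature.MathematicalPhysics.QuantumLattice.dWaveFormFactor L)ᴴ * Literature.MathematicalPhysics.QuantumLattice.pairField Literature.MathematicalPhysics.QuantumLattice.dWaveFormFactor L).toBlock p p)).re) :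
    JmCusp :=
  jmCusp_of_logColdDWaveOrder_of_summableDegeneracy h8807 stub_summableDegeneracy

/-! ### The reshapes are weakenings (documentation form, no sorry) -/

/-- **The rev-1 residue implies the rev-2 residue.**  `stub_noPersistentFloorMultiplet` (rev ≤ c11-1: from one `L₁`
on, simple-floor couplings dense in EVERY sub-window of the whole ordered window) implies `stub_genericSimplicity`
(density on ONE sub-window): take the sub-window to be the window itself.  So the reshape only weakened the
conjecture-grade input; nothing a disprover established against the old form is lost. [folklore] -/
theorem genericSimplicity_of_noPersistentFloorMultiplet
    (hOld : ∀ δ ∈ Set.Ioo (0:ℝ) (1 / 2), ∀ a b : ℝ, 0 < a → a < b →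
      (∀ U ∈ Set.Ioo a b, ∃ c : ℝ, 0 < c ∧ ∀ ε : ℝ, 0 < ε → ∃ L₀ : ℕ, ∀ (L : ℕ) [NeZero L], Even L → L₀ ≤ L → ∃ n : ℕ, (n = 2 * ⌊(1 - δ) * (L : ℝ) ^ 2 / 2⌋₊ ∨ n = 2 * ⌊(1 - δ) * (L : ℝ) ^ 2 / 2⌋₊ - 2) ∧ ∃ v : Literature.MathematicalPhysics.QuantumLattice.Fock (Literature.MathematicalPhysics.QuantumLattice.Orb (Literature.MathematicalPhysics.QuantumLattice.FermionTorus 2 L)), v ∈ Literature.MathematicalPhysics.QuantumLattice.szSector n 0 ∧ star v ⬝ᵥ v = 1 ∧ (star v ⬝ᵥ (Literature.MathematicalPhysics.QuantumLattice.hubbardTorus 2 L 1 U *ᵥ v)).re ≤ (Literature.MathematicalPhysics.QuantumLattice.hubbardTorus 2 L 1 U).minEnergyOn (Literature.MathematicalPhysics.QuantumLattice.szSector n 0) + ε * (L : ℝ) ^ 2 ∧ c * (L : ℝ) ^ 4 ≤ (star (Literature.MathematicalPhysics.QuantumLattice.pairField Literature.MathematicalPhysics.QuantumLattice.dWaveFormFactor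 L *ᵥ v) ⬝ᵥ (Literature.MathematicalPhysics.QuantumLattice.pairField Literature.MathematicalPhysics.QuantumLattice.dWaveFormFactor L *ᵥ v)).re) →
      ∃ L₁ : ℕ, ∀ (L : ℕ) [NeZero L], Even L → L₁ ≤ L → ∀ a' b' : ℝ, a ≤ a' → a' < b' → b' ≤ b →
        ∃ U ∈ Set.Ioo a' b', ∀ φ φ' : Literature.MathematicalPhysics.QuantumLattice.Fock (Literature.MathematicalPhysics.QuantumLattice.Orb (Literature.MathematicalPhysics.QuantumLattice.FermionTorus 2 L)), Literature.MathematicalPhysics.QuantumLattice.IsGroundStateInSector (Literature.MathematicalPhysics.QuantumLattice.hubbardTorus 2 L 1 U) (2 * ⌊(1 - δ) * (L : ℝ) ^ 2 / 2⌋₊) 0 φ → Literature.MathematicalPhysics.QuantumLattice.IsGroundStateInSector (Literature.MathematicalPhysics.QuantumLattice.hubbardTorus 2 L 1 U) (2 * ⌊(1 - δ) * (L : ℝ) ^ 2 / 2⌋₊) 0 φ' → ∃ c : ℂ, φ' = c • φ) :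
    ∀ δ ∈ Set.Ioo (0:ℝ) (1 / 2), ∀ a b : ℝ, 0 < a → a < b → (∀ U ∈ Set.Ioo a b, ∃ c : ℝ, 0 < c ∧ ∀ ε : ℝ, 0 < ε → ∃ L₀ : ℕ, ∀ (L : ℕ) [NeZero L], Even L → L₀ ≤ L → ∃ n : ℕ, (n = 2 * ⌊(1 - δ) * (L : ℝ) ^ 2 / 2⌋₊ ∨ n = 2 * ⌊(1 - δ) * (L : ℝ) ^ 2 / 2⌋₊ - 2) ∧ ∃ v : Literature.MathematicalPhysics.QuantumLattice.Fock (Literature.MathematicalPhysics.QuantumLattice.Orb (Literature.MathematicalPhysics.QuantumLattice.FermionTorus 2 L)), v ∈ Literature.MathematicalPhysics.QuantumLattice.szSector n 0 ∧ star v ⬝ᵥ v = 1 ∧ (star v ⬝ᵥ (Literature.MathematicalPhysics.QuantumLattice.hubbardTorus 2 L 1 U *ᵥ v)).re ≤ (Literature.MathematicalPhysics.QuantumLattice.hubbardTorus 2 L 1 U).minEnergyOn (Literature.MathematicalPhysics.QuantumLattice.szSector n 0) + ε * (L : ℝ) ^ 2 ∧ c * (L : ℝ) ^ 4 ≤ (star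 (Literature.MathematicalPhysics.QuantumLattice.pairField Literature.MathematicalPhysics.QuantumLattice.dWaveFormFactor L *ᵥ v) ⬝ᵥ (Literature.MathematicalPhysics.QuantumLattice.pairField Literature.MathematicalPhysics.QuantumLattice.dWaveFormFactor L *ᵥ v)).re) → ∃ a' b' : ℝ, a ≤ a' ∧ a' < b' ∧ b' ≤ b ∧ ∃ L₁ : ℕ, ∀ (L : ℕ) [NeZero L], Even L → L₁ ≤ L → ∀ a'' b'' : ℝ, a' ≤ a'' → a'' < b'' → b'' ≤ b' → ∃ U ∈ Set.Ioo a'' b'', ∀ φ φ' : Literature.MathematicalPhysics.QuantumLattice.Fock (Literature.MathematicalPhysics.QuantumLattice.Orb (Literature.MathematicalPhysics.QuantumLattice.FermionTorus 2 L)), Literature.MathematicalPhysics.QuantumLattice.IsGroundStateInSector (Literature.MathematicalPhysics.QuantumLattice.hubbardTorus 2 L 1 U) (2 * ⌊(1 - δ) * (L : ℝ) ^ 2 / 2⌋₊) 0 φ → Literature.MathematicalPhysics.QuantumLattice.IsGroundStateInSector (Literature.MathematicalPhysics.QuantumLattice.hubbardTorus 2 L 1 U) (2 * ⌊(1 - δ)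 * (L : ℝ) ^ 2 / 2⌋₊) 0 φ' → ∃ c : ℂ, φ' = c • φ := by
  intro δ hδ a b ha hab hZ
  obtain ⟨L₁, hdense⟩ := hOld δ hδ a b ha hab hZ
  exact ⟨a, b, le_rfl, hab, le_rfl, L₁, fun L _ hE hL => hdense L hE hL⟩

/-- **The rev-2 residue implies the rev-3 residue.**  `stub_genericSimplicity` (rev c11-2: a sub-window with eventually
dense simple-floor couplings) implies `stub_summableDegeneracy` (rev c11-3) on the same sub-window: density leaves
finitely many degenerate couplings at each large even `L` (`stub_pencilFiniteness`, p152004), finite sets are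
Lebesgue-null, and a series with finitely many non-zero finite terms is finite.  So the reshape rev c11-2 → c11-3 only
WEAKENED the conjecture-grade input (tree form: `summableDegeneracy_of_genericSimplicity`). [folklore] -/
theorem summableDegeneracy_of_genericSimplicity'
    (hR2 : ∀ δ ∈ Set.Ioo (0:ℝ) (1 / 2), ∀ a b : ℝ, 0 < a → a < b → (∀ U ∈ Set.Ioo a b, ∃ c : ℝ, 0 < c ∧ ∀ ε : ℝ, 0 < ε → ∃ L₀ : ℕ, ∀ (L : ℕ) [NeZero L], Even L → L₀ ≤ L → ∃ n : ℕ, (n = 2 * ⌊(1 - δ) * (L : ℝ) ^ 2 / 2⌋₊ ∨ n = 2 * ⌊(1 - δ) * (L : ℝ) ^ 2 / 2⌋₊ - 2) ∧ ∃ v : Literature.MathematicalPhysics.QuantumLattice.Fock (Literature.MathematicalPhysics.QuantumLattice.Orb (Literature.MathematicalPhysics.QuantumLattice.FermionTorus 2 L)), v ∈ Literature.MathematicalPhysics.QuantumLattice.szSector n 0 ∧ star v ⬝ᵥ v = 1 ∧ (star v ⬝ᵥ (Literature.MathematicalPhysics.QuantumLattice.hubbardTorus 2 L 1 U *ᵥ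 v)).re ≤ (Literature.MathematicalPhysics.QuantumLattice.hubbardTorus 2 L 1 U).minEnergyOn (Literature.MathematicalPhysics.QuantumLattice.szSector n 0) + ε * (L : ℝ) ^ 2 ∧ c * (L : ℝ) ^ 4 ≤ (star (Literature.MathematicalPhysics.QuantumLattice.pairField Literature.MathematicalPhysics.QuantumLattice.dWaveFormFactor L *ᵥ v) ⬝ᵥ (Literature.MathematicalPhysics.QuantumLattice.pairField Literature.MathematicalPhysics.QuantumLattice.dWaveFormFactor L *ᵥ v)).re) → ∃ a' b' : ℝ, a ≤ a' ∧ a' < b' ∧ b' ≤ b ∧ ∃ L₁ : ℕ, ∀ (L : ℕ) [NeZero L], Even L → L₁ ≤ L → ∀ a'' b'' : ℝ, a' ≤ a'' → a'' < b'' → b'' ≤ b' → ∃ U ∈ Set.Ioo a'' b'', ∀ φ φ' : Literature.MathematicalPhysics.QuantumLattice.Fock (Literature.MathematicalPhysics.QuantumLattice.Orb (Literature.MathematicalPhysics.QuantumLattice.FermionTorus 2 L)), Literature.MathematicalPhysics.QuantumLattice.IsGroundStateInSector (Literature.MathematicalPhysics.QuantumLattice.hubbardTorus 2 L 1 U) (2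 * ⌊(1 - δ) * (L : ℝ) ^ 2 / 2⌋₊) 0 φ → Literature.MathematicalPhysics.QuantumLattice.IsGroundStateInSector (Literature.MathematicalPhysics.QuantumLattice.hubbardTorus 2 L 1 U) (2 * ⌊(1 - δ) * (L : ℝ) ^ 2 / 2⌋₊) 0 φ' → ∃ c : ℂ, φ' = c • φ) :
    ∀ δ ∈ Set.Ioo (0:ℝ) (1 / 2), ∀ a b : ℝ, 0 < a → a < b → (∀ U ∈ Set.Ioo a b, ∃ c : ℝ, 0 < c ∧ ∀ ε : ℝ, 0 < ε → ∃ L₀ : ℕ, ∀ (L : ℕ) [NeZero L], Even L → L₀ ≤ L → ∃ n : ℕ, (n = 2 * ⌊(1 - δ) * (L : ℝ) ^ 2 / 2⌋₊ ∨ n = 2 * ⌊(1 - δ) * (L : ℝ) ^ 2 / 2⌋₊ - 2) ∧ ∃ v : Literature.MathematicalPhysics.QuantumLattice.Fock (Literature.MathematicalPhysics.QuantumLattice.Orb (Literature.MathematicalPhysics.QuantumLattice.FermionTorus 2 L)), v ∈ Literature.MathematicalPhysics.QuantumLattice.szSector n 0 ∧ star v ⬝ᵥ v = 1 ∧ (star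 v ⬝ᵥ (Literature.MathematicalPhysics.QuantumLattice.hubbardTorus 2 L 1 U *ᵥ v)).re ≤ (Literature.MathematicalPhysics.QuantumLattice.hubbardTorus 2 L 1 U).minEnergyOn (Literature.MathematicalPhysics.QuantumLattice.szSector n 0) + ε * (L : ℝ) ^ 2 ∧ c * (L : ℝ) ^ 4 ≤ (star (Literature.MathematicalPhysics.QuantumLattice.pairField Literature.MathematicalPhysics.QuantumLattice.dWaveFormFactor L *ᵥ v) ⬝ᵥ (Literature.MathematicalPhysics.QuantumLattice.pairField Literature.MathematicalPhysics.QuantumLattice.dWaveFormFactor L *ᵥ v)).re) → ∃ a' b' : ℝ, a ≤ a' ∧ a' < b' ∧ b' ≤ b ∧ ∑' L : ℕ, MeasureTheory.volume {U : ℝ | U ∈ Set.Ioo a' b' ∧ L ≠ 0 ∧ Even L ∧ ¬ ∀ φ φ' : Literature.MathematicalPhysics.QuantumLattice.Fock (Literature.MathematicalPhysics.QuantumLattice.Orb (Literature.MathematicalPhysics.QuantumLattice.FermionTorus 2 L)), Literature.MathematicalPhysics.QuantumLattice.IsGroundStateInSector (Literature.MathematicalPhysics.QuantumLattice.hubbardTorus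 2 L 1 U) (2 * ⌊(1 - δ) * (L : ℝ) ^ 2 / 2⌋₊) 0 φ → Literature.MathematicalPhysics.QuantumLattice.IsGroundStateInSector (Literature.MathematicalPhysics.QuantumLattice.hubbardTorus 2 L 1 U) (2 * ⌊(1 - δ) * (L : ℝ) ^ 2 / 2⌋₊) 0 φ' → ∃ c : ℂ, φ' = c • φ} ≠ ⊤ := by
  intro δ hδ a b ha hab hZ
  obtain ⟨a', b', haa', ha'b', hb'b, L₁, hdense⟩ := hR2 δ hδ a b ha hab hZ
  refine ⟨a', b', haa', ha'b', hb'b, ?_⟩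
  -- termwise: zero from `L₁` on, finite before
  have hzero : ∀ L ∉ Finset.range L₁, MeasureTheory.volume {U : ℝ | U ∈ Set.Ioo a' b' ∧ L ≠ 0 ∧ Even L ∧ ¬ ∀ φ φ' : Fock (Orb (FermionTorus 2 L)), IsGroundStateInSector (hubbardTorus 2 L 1 U) (2 * ⌊(1 - δ) * (L : ℝ) ^ 2 / 2⌋₊) 0 φ → IsGroundStateInSector (hubbardTorus 2 L 1 U) (2 * ⌊(1 - δ) * (L : ℝ) ^ 2 / 2⌋₊) 0 φ' → ∃ c : ℂ, φ' = c • φ} = 0 := by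
    intro L hL
    rw [Finset.mem_range, not_lt] at hL
    by_cases hL0 : L = 0
    · have : {U : ℝ | U ∈ Set.Ioo a' b' ∧ L ≠ 0 ∧ Even L ∧ ¬ ∀ φ φ' : Fock (Orb (FermionTorus 2 L)), IsGroundStateInSector (hubbardTorus 2 L 1 U) (2 * ⌊(1 - δ) * (L : ℝ) ^ 2 / 2⌋₊) 0 φ → IsGroundStateInSector (hubbardTorus 2 L 1 U) (2 * ⌊(1 - δ) * (L : ℝ) ^ 2 / 2⌋₊) 0 φ' → ∃ c : ℂ, φ' = c • φ} = ∅ :=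
        Set.eq_empty_of_forall_notMem fun U hU => hU.2.1 hL0
      rw [this, MeasureTheory.measure_empty]
    by_cases hE : Even L
    · haveI : NeZero L := ⟨hL0⟩
      refine ((stub_pencilFiniteness L δ a' b' ha'b' (hdense L hE hL)).subset ?_).measure_zero _
      exact fun U hU => ⟨hU.1, hU.2.2.2⟩
    · have : {U : ℝ | U ∈ Set.Ioo a' b' ∧ L ≠ 0 ∧ Even L ∧ ¬ ∀ φ φ' : Fock (Orb (FermionTorus 2 L)), IsGroundStateInSector (hubbardTorus 2 L 1 U) (2 * ⌊(1 - δ) * (L : ℝ) ^ 2 / 2⌋₊) 0 φ → IsGroundStateInSector (hubbardTorus 2 L 1 U) (2 * ⌊(1 - δ) * (L : ℝ) ^ 2 / 2⌋₊) 0 φ' → ∃ c : ℂ, φ' = c • φ} = ∅ :=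
        Set.eq_empty_of_forall_notMem fun U hU => hE hU.2.2.1
      rw [this, MeasureTheory.measure_empty]
  rw [tsum_eq_sum hzero]
  refine ENNReal.sum_ne_top.2 fun L _ => ?_
  refine ne_top_of_le_ne_top (b := MeasureTheory.volume (Set.Ioo a' b')) ?_
    (MeasureTheory.measure_mono fun U hU => hU.1)
  rw [Real.volume_Ioo]
  exact ENNReal.ofReal_ne_top

end Summit.HubbardSuperconductivity.HubbardSuperconductivity.Cruxes.JmCusp.Lines.CocountableCouplingSelection

end
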